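import Literature.Probability.RandomPlanarGeometry.ConformalMapRiemannProofs
import Mathlib.Analysis.Complex.Schwarz
import HarnessLib

/-!
# The Riemann mapping theorem for `Literature.Probability.RandomPlanarGeometry.ConformalEquiv`, normalised form: existence and uniqueness

`Literature.Probability.RandomPlanarGeometry.ConformalMap` states the normalised Riemann mapping
theorem as the named fact `Literature.Probability.RandomPlanarGeometry.existsUnique_conformalEquiv_ball` (Ahlfors, Ch. 6 §1.1 Thm. 1: for
`U ⊊ ℂ` open and simply connected and `z₀ ∈ U` there is a *unique* conformal equivalence
`φ : U → 𝔻` with `φ z₀ = 0` and `φ' z₀ > 0`). The sibling file `ConformalMapRiemannProofs.lean`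
discharges the un-normalised forms (`Literature.Probability.RandomPlanarGeometry.exists_conformalEquiv_ball_holds`,
`Literature.Probability.RandomPlanarGeometry.exists_conformalEquiv_ball_apply_eq_zero`) from the Riemann mapping theorem proved in
`Literature.Analysis.Complex.RiemannMapping` (Montel, Hurwitz, Koebe square-root trick; Conway
VII.4.2). The present file discharges the normalised form as
`Literature.Probability.RandomPlanarGeometry.existsUnique_conformalEquiv_ball_holds`, following the printed proof:

* existence (`Literature.Probability.RandomPlanarGeometry.exists_conformalEquiv_ball_deriv_pos`): rotate the based Riemann map `f` of
  `Complex.exists_bijOn_ball_of_isSimplyConnected` (`f z₀ = 0`, `f' ≠ 0` on `U`) by the unimodular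
  constant `c = conj f'(z₀) / |f'(z₀)|`, so that `(c f)' z₀ = |f'(z₀)| > 0`; the inverse of `c f` is
  holomorphic by `Complex.differentiableOn_invFunOn_image`;
* uniqueness (`Literature.Probability.RandomPlanarGeometry.ConformalEquiv.eqOn_of_deriv_pos`, Ahlfors's argument): for two normalised maps
  `φ, ψ`, `h = ψ ∘ φ⁻¹` is a conformal automorphism of `𝔻` fixing `0`; the Schwarz lemma applied to
  `h` and to `h⁻¹ = φ ∘ ψ⁻¹` gives `‖h w‖ = ‖w‖`, the equality case of the Schwarz lemma
  (`Complex.affine_of_mapsTo_ball_of_norm_dslope_eq_div`) makes `h` a rotation `w ↦ C w` with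
  `‖C‖ = 1`, whence `ψ = C φ` on `U` and `ψ' z₀ = C φ' z₀`; positivity of both derivatives forces
  `C = 1`.

This file is kept separate from `ConformalMapRiemannProofs.lean` because it needs the extra import
`Mathlib.Analysis.Complex.Schwarz` and nothing downstream of that file uses the normalised form.

## Mathlib

We USE the Schwarz lemma and its equality case (`Complex.norm_le_norm_of_mapsTo_ball`,
`Complex.affine_of_mapsTo_ball_of_norm_dslope_eq_div` of `Mathlib/Analysis/Complex/Schwarz.lean`),
`dslope`, `deriv_const_mul_field`, `Filter.EventuallyEq.deriv_eq`, and from Literature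
`Literature.Probability.RandomPlanarGeometry.ConformalEquiv.ofBijOn`, `Complex.exists_bijOn_ball_of_isSimplyConnected`,
`Complex.differentiableOn_invFunOn_image`.

## References

* L. V. Ahlfors, *Complex Analysis*, 3rd ed., McGraw-Hill (1979), Ch. 6 §1.1, Thm. 1 (Riemann
  mapping theorem, with the uniqueness proof via the Schwarz lemma preceding the existence proof);
  in the 1st ed. (1953) the same statement and uniqueness proof are Chap. IV §4.2, Thm. 10,
  pp. 172–174.
* J. B. Conway, *Functions of One Complex Variable I*, 2nd ed., GTM 11 (1978), Ch. VII Thm. 4.2.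
-/

noncomputable section

open Set Filter Topology Complex Metric

namespace Literature.Probability.RandomPlanarGeometry

/-! ### The Riemann mapping theorem, normalised form: existence and uniqueness -/

section Normalised

variable {U : Set ℂ}

/-- **Riemann mapping theorem, normalised existence**: for `U ⊊ ℂ` open and simply connected and
`z₀ ∈ U` there is a conformal equivalence `φ : U → 𝔻` with `φ z₀ = 0` and `φ' z₀ > 0` (real and
positive). Obtained from the based Riemann map `f` of
`Complex.exists_bijOn_ball_of_isSimplyConnected` (`f z₀ = 0`, `f' ≠ 0` on `U`) by the rotation
`φ = c • f`, `c = conj f'(z₀) / |f'(z₀)|`, for which `φ' z₀ = |f'(z₀)|`; the inverse of `φ` is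
holomorphic by `Complex.differentiableOn_invFunOn_image`. Ahlfors, *Complex Analysis* (1979),
Ch. 6 §1.1, Thm 1 (1st ed. 1953: Chap. IV §4.2 Thm. 10). [cite: AhlforsCA1979, Ch. 6 §1.1 Thm. 1] -/
theorem exists_conformalEquiv_ball_deriv_pos (hU : IsOpen U) (hsc : IsSimplyConnected U)
    (hU' : U ≠ univ) {z₀ : ℂ} (hz₀ : z₀ ∈ U) :
    ∃ φ : ConformalEquiv U (ball 0 1), φ z₀ = 0 ∧ 0 < (deriv φ z₀).re ∧ (deriv φ z₀).im = 0 := by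
  obtain ⟨f, hf, hbij, h0, hf', -⟩ := Complex.exists_bijOn_ball_of_isSimplyConnected hU hsc hU' hz₀
  -- the rotation constant `c = conj a / ‖a‖`, `a = f' z₀ ≠ 0`
  set a : ℂ := deriv f z₀ with ha_def
  have ha : a ≠ 0 := hf' z₀ hz₀
  have hna : (‖a‖ : ℂ) ≠ 0 := by exact_mod_cast norm_ne_zero_iff.2 ha
  set c : ℂ := (starRingEnd ℂ) a / (‖a‖ : ℂ) with hc_def
  have hc1 : ‖c‖ = 1 := by
    rw [hc_def, norm_div, Complex.norm_conj, Complex.norm_real, Real.norm_of_nonneg (norm_nonneg _),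
      div_self (norm_ne_zero_iff.2 ha)]
  have hc0 : c ≠ 0 := by
    rw [← norm_ne_zero_iff, hc1]
    exact one_ne_zero
  -- the rotated map `g = c • f`
  set g : ℂ → ℂ := fun z ↦ c * f z with hg_def
  have hg : DifferentiableOn ℂ g U := hf.const_mul c
  have hdg : ∀ z, deriv g z = c * deriv f z := fun z ↦ by
    rw [hg_def, deriv_const_mul_field]
  have hg' : ∀ z ∈ U, deriv g z ≠ 0 := fun z hz ↦ by
    rw [hdg]
    exact mul_ne_zero hc0 (hf' z hz)
  have hmaps : MapsTo g U (ball 0 1) := fun z hz ↦ by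
    have h := hbij.mapsTo hz
    rw [mem_ball_zero_iff] at h ⊢
    rwa [hg_def, norm_mul, hc1, one_mul]
  have hinj : InjOn g U := fun x hx y hy hxy ↦ hbij.injOn hx hy (mul_left_cancel₀ hc0 hxy)
  have hsurj : SurjOn g U (ball 0 1) := fun w hw ↦ by
    have hw' : c⁻¹ * w ∈ ball (0 : ℂ) 1 := by
      rw [mem_ball_zero_iff] at hw ⊢
      rwa [norm_mul, norm_inv, hc1, inv_one, one_mul]
    obtain ⟨z, hz, hzw⟩ := hbij.surjOn hw'
    exact ⟨z, hz, by simp only [hg_def, hzw, mul_inv_cancel_left₀ hc0]⟩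
  have hbij' : BijOn g U (ball 0 1) := ⟨hmaps, hinj, hsurj⟩
  have hinv : DifferentiableOn ℂ (Function.invFunOn g U) (ball 0 1) := by
    rw [← hbij'.image_eq]
    exact Complex.differentiableOn_invFunOn_image hU hg hinj hg'
  -- the derivative of `g` at `z₀` is `‖a‖ > 0`
  have hderiv : deriv g z₀ = (‖a‖ : ℂ) := by
    rw [hdg, ← ha_def, hc_def, div_mul_eq_mul_div, Complex.conj_mul', sq, mul_div_assoc,
      div_self hna, mul_one]
  refine ⟨ConformalEquiv.ofBijOn g hg hbij' hinv, ?_, ?_⟩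
  · rw [ConformalEquiv.ofBijOn_apply, hg_def]
    simp only [h0, mul_zero]
  · have hcoe : ((ConformalEquiv.ofBijOn g hg hbij' hinv : ConformalEquiv U (ball 0 1)) : ℂ → ℂ) =
        g := rfl
    rw [hcoe, hderiv]
    exact ⟨by exact_mod_cast norm_pos_iff.2 ha, Complex.ofReal_im _⟩

/-- **Riemann mapping theorem, uniqueness** (Ahlfors's argument): two conformal equivalences
`φ ψ : U → 𝔻` with `φ z₀ = ψ z₀ = 0` and `φ' z₀ > 0`, `ψ' z₀ > 0` agree on `U`. Indeed
`h = ψ ∘ φ⁻¹` is a conformal automorphism of `𝔻` fixing `0`; the Schwarz lemma for `h` and for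
`h⁻¹` gives `‖h w‖ = ‖w‖`, so by the equality case of the Schwarz lemma `h w = C w` with `‖C‖ = 1`,
whence `ψ = C φ` on `U` and `ψ' z₀ = C φ' z₀`; positivity of both derivatives forces `C = 1`.
Ahlfors, *Complex Analysis* (1979), Ch. 6 §1.1, Thm 1, uniqueness part (1st ed. 1953: Chap. IV
§4.2 Thm. 10, p. 172). [cite: AhlforsCA1979, Ch. 6 §1.1 Thm. 1] -/
theorem ConformalEquiv.eqOn_of_deriv_pos (hU : IsOpen U) {z₀ : ℂ} (hz₀ : z₀ ∈ U)
    (φ ψ : ConformalEquiv U (ball 0 1)) (hφ0 : φ z₀ = 0) (hψ0 : ψ z₀ = 0)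
    (hφre : 0 < (deriv φ z₀).re) (hφim : (deriv φ z₀).im = 0)
    (hψre : 0 < (deriv ψ z₀).re) (hψim : (deriv ψ z₀).im = 0) : EqOn ψ φ U := by
  -- the disc automorphisms `h = ψ ∘ φ⁻¹` and `k = φ ∘ ψ⁻¹`
  set h : ConformalEquiv (ball (0 : ℂ) 1) (ball 0 1) := φ.symm.trans ψ with hh_def
  set k : ConformalEquiv (ball (0 : ℂ) 1) (ball 0 1) := ψ.symm.trans φ with hk_def
  have hφs : φ.symm 0 = z₀ := by simpa only [hφ0] using φ.symm_apply_apply hz₀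
  have hψs : ψ.symm 0 = z₀ := by simpa only [hψ0] using ψ.symm_apply_apply hz₀
  have hh0 : h 0 = 0 := by rw [hh_def, ConformalEquiv.trans_apply, hφs, hψ0]
  have hk0 : k 0 = 0 := by rw [hk_def, ConformalEquiv.trans_apply, hψs, hφ0]
  have hkh : ∀ w ∈ ball (0 : ℂ) 1, k (h w) = w := fun w hw ↦ by
    rw [hk_def, hh_def, ConformalEquiv.trans_apply, ConformalEquiv.trans_apply,
      ψ.symm_apply_apply (φ.symm_mapsTo hw), φ.apply_symm_apply hw]
  -- Schwarz lemma for `h` and for `k`: `‖h w‖ = ‖w‖`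
  have hle : ∀ (e : ConformalEquiv (ball (0 : ℂ) 1) (ball 0 1)), e 0 = 0 →
      ∀ w ∈ ball (0 : ℂ) 1, ‖e w‖ ≤ ‖w‖ := fun e he0 w hw ↦
    Complex.norm_le_norm_of_mapsTo_ball e.differentiableOn_coe
      (e.mapsTo.mono_right ball_subset_closedBall) he0 (mem_ball_zero_iff.1 hw)
  have hnorm : ∀ w ∈ ball (0 : ℂ) 1, ‖h w‖ = ‖w‖ := fun w hw ↦
    le_antisymm (hle h hh0 w hw) <| by
      calc ‖w‖ = ‖k (h w)‖ := by rw [hkh w hw]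
        _ ≤ ‖h w‖ := hle k hk0 (h w) (h.mapsTo hw)
  -- equality case of the Schwarz lemma at `z₁ = 1/2`: `h` is the rotation `w ↦ C w`
  set z₁ : ℂ := 1 / 2 with hz₁_def
  have hz₁ : z₁ ∈ ball (0 : ℂ) 1 := by
    rw [mem_ball_zero_iff, hz₁_def]
    norm_num
  have hz₁0 : z₁ ≠ 0 := by
    rw [hz₁_def]
    norm_num
  set C : ℂ := dslope h 0 z₁ with hC_def
  have hCz₁ : C = z₁⁻¹ * h z₁ := by
    rw [hC_def, dslope_of_ne _ hz₁0, slope_def_module, sub_zero, hh0, sub_zero, smul_eq_mul]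
  have hC1 : ‖C‖ = 1 := by
    rw [hCz₁, norm_mul, norm_inv, hnorm z₁ hz₁, inv_mul_cancel₀ (norm_ne_zero_iff.2 hz₁0)]
  have haff : EqOn h (fun w ↦ h 0 + (w - 0) • dslope h 0 z₁) (ball 0 1) :=
    Complex.affine_of_mapsTo_ball_of_norm_dslope_eq_div h.differentiableOn_coe
      (by simpa only [hh0] using h.mapsTo.mono_right ball_subset_closedBall) hz₁
      (by rw [← hC_def, hC1, div_one])
  have hrot : ∀ w ∈ ball (0 : ℂ) 1, h w = C * w := fun w hw ↦ by
    have h1 := haff hw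
    simp only [hh0, zero_add, sub_zero, smul_eq_mul] at h1
    rw [h1, hC_def, mul_comm]
  -- hence `ψ = C • φ` on `U`
  have hψφ : ∀ w ∈ U, ψ w = C * φ w := fun w hw ↦ by
    rw [← hrot (φ w) (φ.mapsTo hw), hh_def, ConformalEquiv.trans_apply, φ.symm_apply_apply hw]
  -- compare derivatives at `z₀`: `ψ' z₀ = C φ' z₀`
  have hd : deriv ψ z₀ = C * deriv φ z₀ := by
    have heq : (ψ : ℂ → ℂ) =ᶠ[𝓝 z₀] fun w ↦ C * φ w :=
      Filter.eventuallyEq_of_mem (hU.mem_nhds hz₀) fun w hw ↦ hψφ w hw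
    rw [heq.deriv_eq, deriv_const_mul_field]
  set a : ℂ := deriv φ z₀ with ha_def
  set b : ℂ := deriv ψ z₀ with hb_def
  have ha : a = (a.re : ℂ) := Complex.ext (by simp) (by simp [hφim])
  have hb : b = (b.re : ℂ) := Complex.ext (by simp) (by simp [hψim])
  have ha0 : a ≠ 0 := fun h0 ↦ by
    rw [h0, Complex.zero_re] at hφre
    exact lt_irrefl 0 hφre
  have hna : ‖a‖ = a.re := by
    rw [ha, Complex.norm_real, Real.norm_of_nonneg hφre.le, Complex.ofReal_re]
  have hnb : ‖b‖ = b.re := by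
    rw [hb, Complex.norm_real, Real.norm_of_nonneg hψre.le, Complex.ofReal_re]
  have hab : b = a := by
    have h1 : ‖b‖ = ‖a‖ := by rw [hd, norm_mul, hC1, one_mul]
    rw [hb, ha, ← hnb, ← hna, h1]
  have hC : C = 1 := by
    have h2 : C * a = 1 * a := by rw [one_mul, ← hd, hab]
    exact mul_right_cancel₀ ha0 h2
  intro w hw
  rw [hψφ w hw, hC, one_mul]

/-- **The Riemann mapping theorem, normalised form** (`Literature.Probability.RandomPlanarGeometry.existsUnique_conformalEquiv_ball`
holds): for `U ⊊ ℂ` open and simply connected and `z₀ ∈ U` there is a conformal equivalence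
`φ : U → 𝔻` with `φ z₀ = 0` and `φ' z₀ > 0`, and any two such agree on `U`. Existence:
`Literature.Probability.RandomPlanarGeometry.exists_conformalEquiv_ball_deriv_pos` (Montel–Hurwitz–Koebe extremal proof of
`Literature.Analysis.Complex.RiemannMapping`, then a rotation); uniqueness:
`Literature.Probability.RandomPlanarGeometry.ConformalEquiv.eqOn_of_deriv_pos` (Schwarz lemma). Ahlfors, *Complex Analysis*, 3rd ed.
(1979), Ch. 6 §1.1, Thm 1; 1st ed. (1953), Chap. IV §4.2, Thm. 10,
pp. 172–174. [cite: AhlforsCA1979, Ch. 6 §1.1 Thm. 1] -/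
theorem existsUnique_conformalEquiv_ball_holds : existsUnique_conformalEquiv_ball (U := U) := by
  intro hU hsc hU' z₀ hz₀
  obtain ⟨φ, hφ0, hre, him⟩ := exists_conformalEquiv_ball_deriv_pos hU hsc hU' hz₀
  exact ⟨φ, ⟨hφ0, hre, him⟩, fun ψ hψ0 hψre hψim ↦
    ConformalEquiv.eqOn_of_deriv_pos hU hz₀ φ ψ hφ0 hψ0 hre him hψre hψim⟩

end Normalised

end Literature.Probability.RandomPlanarGeometry

end
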